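import Summits.CriticalPhenomena.PercolationContinuityZ3.Theorems.AdditiveGluing.Negative.CertWeighted

/-!
# `AdditiveGluing` (crux stmt-CriticalPhenomena-4576, route `PercNearOneGluing`):
# the certified PARTITION checker — exact probabilities of a weighted graph by the cluster-partition
# dynamic programme (at most `Bell(n)` states instead of `2^m` configurations)

`CertWeighted.lean` enumerates the `2^m` sub-configurations (fine up to `m ≈ 20`); dense graphs on
`6–9` vertices need the standard remedy certified here: process the edges one at a time and keep the
induced PARTITION of the vertices into open clusters (a labelling `List ℕ`) with its accumulated
weight — closed edge: keep (factor `1 − q_e`), open edge: glue two blocks (factor `q_e`) — coalescing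
equal labellings after a merge sort (`Bell(8) = 4140` states at most on `8` vertices).
* `mergeLab`, `labOf`; `labOf_getD_eq_iff` — **equal labels iff joined by an open path**;
* `coalesce`, `stepP`, `partDist`; `wcnt_partDist` — for EVERY test `P` of the labelling the
  `P`-weight of `partDist n l` is the `P ∘ labOf`-weight of the weighted sub-configurations `wsubs l`;
* `pConn`, `pConnSet`, `pNotConn`, `agPGraph` (same shape as `agWGraph`) and
  `additiveGluing_weighted_of_agPGraph` — **`agPGraph n l = true` implies the additive gluing
  inequality for `prodBernoulli (wOfList l)`, all `A o b t`** (via `prodBernoulli_real_eq_wsum`).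
Samples (`native_decide`): `K₇` at weight `1/2` (`agPGraph_K7half`) and the `8`-vertex gadget
`gadget8` with weights `1/4, 1/2, 3/4`.  Nothing here asserts or refutes the crux.
-/

namespace Summit.CriticalPhenomena.PercolationContinuityZ3.Theorems.AdditiveGluing.Negative.Cert

open MeasureTheory
open Literature.Probability.Percolation Literature.Probability.LatticeModels

/-! ### The partition dynamic programme (computable) -/

section Checker

/-- Relabel `hi ↦ lo`. -/
def relabel (lab : List ℕ) (hi lo : ℕ) : List ℕ := lab.map fun x => if x = hi then lo else x
/-- Glue the blocks of `u` and `v`. -/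
def mergeLab (lab : List ℕ) (u v : ℕ) : List ℕ :=
  if lab.getD u 0 = lab.getD v 0 then lab else relabel lab (lab.getD v 0) (lab.getD u 0)

/-- The cluster labelling of a configuration (vertices `0 … n-1`; edges glued from the right). -/
def labOf (n : ℕ) (ω : List (Fin n × Fin n)) : List ℕ :=
  ω.foldr (fun p lab => mergeLab lab p.1 p.2) (List.range n)

/-- A sort key of a labelling (base `32` digits; only used to bring equal labellings together). -/
def labKey (lab : List ℕ) : ℕ := lab.foldl (fun acc x => acc * 32 + x) 0

/-- Push a weighted state onto a list, adding the weight if the head carries the same state. -/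
def pushW (e : List ℕ × ℚ) : List (List ℕ × ℚ) → List (List ℕ × ℚ)
  | [] => [e]
  | e' :: d => if e.1 = e'.1 then (e.1, e.2 + e'.2) :: d else e :: e' :: d

/-- Coalesce adjacent equal states. -/
def coalesce (d : List (List ℕ × ℚ)) : List (List ℕ × ℚ) := d.foldr pushW []

/-- One edge of the dynamic programme: closed (weight `1 − q`) or open (glue, weight `q`), then sort
and coalesce. -/
def stepP (d : List (List ℕ × ℚ)) (u v : ℕ) (q : ℚ) : List (List ℕ × ℚ) :=
  coalesce (List.mergeSort
    (d.map (fun e => (e.1, e.2 * (1 - q))) ++ d.map (fun e => (mergeLab e.1 u v, e.2 * q)))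
    (fun a b => Nat.ble (labKey a.1) (labKey b.1)))

/-- The weighted distribution of cluster labellings of a weighted edge list. -/
def partDist (n : ℕ) : List (Fin n × Fin n × ℚ) → List (List ℕ × ℚ)
  | [] => [(List.range n, 1)]
  | e :: l => stepP (partDist n l) e.1 e.2.1 e.2.2

/-- The `P`-weight of a distribution. -/
def wcnt (P : List ℕ → Bool) (d : List (List ℕ × ℚ)) : ℚ :=
  (d.map fun e => if P e.1 then e.2 else 0).sum

/-- `P(o ↔ b)`. -/
def pConn (d : List (List ℕ × ℚ)) (o b : ℕ) : ℚ := wcnt (fun s => s.getD o 0 == s.getD b 0) d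
/-- `P(a ↮ b)`. -/
def pNotConn (d : List (List ℕ × ℚ)) (a b : ℕ) : ℚ := wcnt (fun s => !(s.getD a 0 == s.getD b 0)) d

/-- `P(o ↔ A)` (`A` as the bit mask `Am`). -/
def pConnSet (n : ℕ) (d : List (List ℕ × ℚ)) (o Am : ℕ) : ℚ :=
  wcnt (fun s => (List.range n).any fun a => Am.testBit a && (s.getD o 0 == s.getD a 0)) d

/-- THE PARTITION CHECK for one weighted graph: weights in `[0,1]`, distinct unordered pairs, and the
additive gluing inequality (optimal slack) for every `(o, b, A ≠ ∅)`. -/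
def agPGraph (n : ℕ) (l : List (Fin n × Fin n × ℚ)) : Bool :=
  (l.all fun e => decide (0 ≤ e.2.2) && decide (e.2.2 ≤ 1)) && decide (wPairs l).Nodup &&
  (let d := partDist n l
   let cm := (List.range n).map fun o => (List.range n).map fun b => pConn d o b
   let dm := (List.range n).map fun a => (List.range n).map fun b => pNotConn d a b
   let am := (List.range n).map fun o => (List.range (2 ^ n)).map fun Am => pConnSet n d o Am
   (List.range n).all fun o => (List.range n).all fun b => (List.range (2 ^ n)).all fun Am =>
     Am == 0 || (List.range n).any fun a => Am.testBit a &&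
       decide ((am.getD o []).getD Am 0 ≤ (cm.getD o []).getD b 0 + (dm.getD a []).getD b 0))

end Checker

/-! ### Labels are clusters -/

/-- `labOf` of a cons. -/
theorem labOf_cons {n : ℕ} (p : Fin n × Fin n) (ω : List (Fin n × Fin n)) :
    labOf n (p :: ω) = mergeLab (labOf n ω) p.1 p.2 := rfl

/-- Relabelling preserves the length. -/
theorem length_mergeLab (lab : List ℕ) (u v : ℕ) : (mergeLab lab u v).length = lab.length := by
  unfold mergeLab relabel; split_ifs <;> simp

/-- The labelling has length `n`. -/
theorem length_labOf {n : ℕ} : ∀ ω : List (Fin n × Fin n), (labOf n ω).length = n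
  | [] => by simp [labOf]
  | p :: ω => by rw [labOf_cons, length_mergeLab, length_labOf ω]

/-- Entries of a relabelled list. -/
theorem getD_relabel {lab : List ℕ} {hi lo x : ℕ} (hx : x < lab.length) :
    (relabel lab hi lo).getD x 0 = if lab.getD x 0 = hi then lo else lab.getD x 0 := by
  simp only [relabel, List.getD_eq_getElem?_getD, List.getElem?_map,
    List.getElem?_eq_getElem hx, Option.map_some, Option.getD_some]

/-- When two entries of a glued labelling coincide. -/
theorem getD_mergeLab_eq_iff {lab : List ℕ} {u v x y : ℕ} (hx : x < lab.length) (hy : y < lab.length) :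
    (mergeLab lab u v).getD x 0 = (mergeLab lab u v).getD y 0 ↔
      lab.getD x 0 = lab.getD y 0 ∨
        (lab.getD x 0 = lab.getD v 0 ∧ lab.getD y 0 = lab.getD u 0) ∨
        (lab.getD x 0 = lab.getD u 0 ∧ lab.getD y 0 = lab.getD v 0) := by
  unfold mergeLab
  by_cases huv : lab.getD u 0 = lab.getD v 0
  · rw [if_pos huv, huv]; omega
  · rw [if_neg huv, getD_relabel hx, getD_relabel hy]
    split_ifs <;> omega

/-- Gluing only coarsens: equal labels stay equal. -/
theorem getD_mergeLab_eq_of_eq {lab : List ℕ} {u v x y : ℕ} (hx : x < lab.length) (hy : y < lab.length)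
    (h : lab.getD x 0 = lab.getD y 0) :
    (mergeLab lab u v).getD x 0 = (mergeLab lab u v).getD y 0 :=
  (getD_mergeLab_eq_iff hx hy).2 (Or.inl h)

/-- The glued pair gets equal labels. -/
theorem getD_mergeLab_self {lab : List ℕ} {u v : ℕ} (hu : u < lab.length) (hv : v < lab.length) :
    (mergeLab lab u v).getD u 0 = (mergeLab lab u v).getD v 0 :=
  (getD_mergeLab_eq_iff hu hv).2 (Or.inr (Or.inr ⟨rfl, rfl⟩))

/-- Every open pair has equal labels. -/
theorem labOf_getD_eq_of_mem {n : ℕ} : ∀ (ω : List (Fin n × Fin n)) (p : Fin n × Fin n), p ∈ ω →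
    (labOf n ω).getD p.1 0 = (labOf n ω).getD p.2 0
  | [], _, h => by simp at h
  | p' :: ω, p, h => by
    have hl : ∀ z : Fin n, (z : ℕ) < (labOf n ω).length := fun z => by rw [length_labOf]; exact z.2
    rw [labOf_cons]
    rcases List.mem_cons.1 h with rfl | h
    · exact getD_mergeLab_self (hl p.1) (hl p.2)
    · exact getD_mergeLab_eq_of_eq (hl p.1) (hl p.2) (labOf_getD_eq_of_mem ω p h)

/-- Lookup in `List.range`. -/
theorem getD_range {i m : ℕ} (hi : i < m) : (List.range m).getD i 0 = i := by
  rw [List.getD_eq_getElem?_getD, List.getElem?_range hi]; rfl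

/-- **Equal labels iff joined by an open path.** -/
theorem labOf_getD_eq_iff {n : ℕ} : ∀ (ω : List (Fin n × Fin n)) (x y : Fin n),
    (labOf n ω).getD x 0 = (labOf n ω).getD y 0 ↔ (openGraph (↑(Eset ω) : Set (Sym2 (Fin n)))).Reachable x y
  | [], x, y => by
    simp only [labOf, List.foldr_nil]
    rw [getD_range x.2, getD_range y.2]
    constructor
    · intro h
      have hxy : x = y := Fin.ext h
      subst hxy
      exact SimpleGraph.Reachable.refl _
    · rintro ⟨p⟩
      cases p with
      | nil => rfl
      | cons h _ => exact absurd ((openGraph_adj _ _ _).1 h).1 (by simp [Eset_nil])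
  | p :: ω, x, y => by
    have hl : ∀ z : Fin n, (z : ℕ) < (labOf n ω).length := fun z => by rw [length_labOf]; exact z.2
    have ih := labOf_getD_eq_iff ω
    have hmono : (openGraph (↑(Eset ω) : Set (Sym2 (Fin n)))) ≤
        openGraph (↑(Eset (p :: ω)) : Set (Sym2 (Fin n))) := by
      intro a b hab
      rw [openGraph_adj] at hab ⊢
      rw [Eset_cons, Finset.coe_insert]
      exact ⟨Set.mem_insert_of_mem _ hab.1, hab.2⟩
    constructor
    · intro h
      rw [labOf_cons, getD_mergeLab_eq_iff (hl x) (hl y)] at h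
      have hedge : ∀ {a b : Fin n}, (a = p.1 ∧ b = p.2) ∨ (a = p.2 ∧ b = p.1) →
          (openGraph (↑(Eset (p :: ω)) : Set (Sym2 (Fin n)))).Reachable a b := by
        intro a b hab
        by_cases hne : a = b
        · subst hne; exact SimpleGraph.Reachable.refl _
        · refine SimpleGraph.Adj.reachable ((openGraph_adj _ _ _).2 ⟨?_, hne⟩)
          rw [Eset_cons, Finset.coe_insert]
          refine Set.mem_insert_iff.2 (Or.inl ?_)
          rcases hab with ⟨rfl, rfl⟩ | ⟨rfl, rfl⟩
          · rfl
          · exact Sym2.eq_swap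
      rcases h with h | ⟨h1, h2⟩ | ⟨h1, h2⟩
      · exact ((ih x y).1 h).mono hmono
      · exact (((ih x p.2).1 h1).mono hmono).trans
          ((hedge (Or.inr ⟨rfl, rfl⟩)).trans (((ih p.1 y).1 h2.symm).mono hmono))
      · exact (((ih x p.1).1 h1).mono hmono).trans
          ((hedge (Or.inl ⟨rfl, rfl⟩)).trans (((ih p.2 y).1 h2.symm).mono hmono))
    · rintro ⟨q⟩
      induction q with
      | nil => rfl
      | @cons a b c hadj _ ihq =>
        refine Eq.trans ?_ ihq
        obtain ⟨hab, _⟩ := (openGraph_adj _ _ _).1 hadj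
        rw [Finset.mem_coe, mem_Eset_iff] at hab
        obtain ⟨p', hp', hp'eq⟩ := hab
        rcases hp'eq with rfl | rfl
        · exact labOf_getD_eq_of_mem (p :: ω) (a, b) hp'
        · exact (labOf_getD_eq_of_mem (p :: ω) (b, a) hp').symm

/-! ### The dynamic programme computes weighted counts of the labelling -/

/-- `wcnt` of a cons. -/
theorem wcnt_cons (P : List ℕ → Bool) (e : List ℕ × ℚ) (d : List (List ℕ × ℚ)) :
    wcnt P (e :: d) = (if P e.1 then e.2 else 0) + wcnt P d := by simp [wcnt]

/-- `wcnt` of an append. -/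
theorem wcnt_append (P : List ℕ → Bool) (d d' : List (List ℕ × ℚ)) :
    wcnt P (d ++ d') = wcnt P d + wcnt P d' := by simp [wcnt, List.sum_append]

/-- Pushing preserves weighted counts. -/
theorem wcnt_pushW (P : List ℕ → Bool) (e : List ℕ × ℚ) (d : List (List ℕ × ℚ)) :
    wcnt P (pushW e d) = (if P e.1 then e.2 else 0) + wcnt P d := by
  cases d with
  | nil => simp [pushW, wcnt]
  | cons e' d =>
    simp only [pushW]
    by_cases h : e.1 = e'.1
    · rw [if_pos h, wcnt_cons, wcnt_cons]
      dsimp only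
      rw [h]
      split_ifs <;> ring
    · rw [if_neg h, wcnt_cons]

/-- `coalesce` of a cons. -/
theorem coalesce_cons (e : List ℕ × ℚ) (d : List (List ℕ × ℚ)) :
    coalesce (e :: d) = pushW e (coalesce d) := rfl

/-- Coalescing preserves weighted counts. -/
theorem wcnt_coalesce (P : List ℕ → Bool) : ∀ d : List (List ℕ × ℚ), wcnt P (coalesce d) = wcnt P d
  | [] => rfl
  | e :: d => by rw [coalesce_cons, wcnt_pushW, wcnt_coalesce P d, wcnt_cons]

/-- A permutation preserves weighted counts. -/
theorem wcnt_perm (P : List ℕ → Bool) {d d' : List (List ℕ × ℚ)} (h : d.Perm d') :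
    wcnt P d = wcnt P d' := (h.map _).sum_eq

/-- Weighted counts of one step. -/
theorem wcnt_stepP (P : List ℕ → Bool) (d : List (List ℕ × ℚ)) (u v : ℕ) (q : ℚ) :
    wcnt P (stepP d u v q) = (1 - q) * wcnt P d + q * wcnt (fun s => P (mergeLab s u v)) d := by
  rw [stepP, wcnt_coalesce, wcnt_perm P (List.mergeSort_perm _ _), wcnt_append]
  simp only [wcnt, List.map_map]
  rw [← List.sum_map_mul_left, ← List.sum_map_mul_left]
  congr 1
  · exact congrArg _ (List.map_congr_left fun e _ => by
      simp only [Function.comp_apply]; split_ifs <;> ring)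
  · exact congrArg _ (List.map_congr_left fun e _ => by
      simp only [Function.comp_apply]; split_ifs <;> ring)

/-- **The dynamic programme is exact**: for every test `P` of the labelling, the `P`-weight of
`partDist n l` is the `P ∘ labOf`-weight of the `2^m` weighted sub-configurations. -/
theorem wcnt_partDist {n : ℕ} : ∀ (l : List (Fin n × Fin n × ℚ)) (P : List ℕ → Bool),
    wcnt P (partDist n l) = ((wsubs l).map fun c => if P (labOf n c.1) then c.2 else 0).sum
  | [], P => by simp [partDist, wsubs, wcnt, labOf]
  | e :: l, P => by
    rw [partDist, wcnt_stepP, wcnt_partDist l P, wcnt_partDist l]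
    simp only [wsubs, List.map_append, List.map_map, List.sum_append]
    rw [← List.sum_map_mul_left, ← List.sum_map_mul_left]
    congr 1
    · exact congrArg _ (List.map_congr_left fun c _ => by
        simp only [Function.comp_apply]; split_ifs <;> ring)
    · exact congrArg _ (List.map_congr_left fun c _ => by
        simp only [Function.comp_apply, labOf_cons]; split_ifs <;> ring)

/-! ### The three probabilities -/

/-- A `wcnt` of the dynamic programme, cast to `ℝ`, is the `wsum` of the corresponding event. -/
theorem cast_wcnt_partDist {n : ℕ} (l : List (Fin n × Fin n × ℚ)) (P : List ℕ → Bool)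
    (Q : Finset (Sym2 (Fin n)) → Prop) [DecidablePred Q]
    (hPQ : ∀ ω : List (Fin n × Fin n), P (labOf n ω) = true ↔ Q (Eset ω)) :
    ((wcnt P (partDist n l) : ℚ) : ℝ) = wsum l fun S => if Q S then (1 : ℝ) else 0 := by
  rw [wcnt_partDist, wsum, Rat.cast_list_sum, List.map_map]
  congr 1
  refine List.map_congr_left fun c _ => ?_
  simp only [Function.comp_apply]
  by_cases hQ : Q (Eset c.1)
  · rw [if_pos ((hPQ c.1).2 hQ), if_pos hQ, mul_one]
  · rw [if_neg (fun h => hQ ((hPQ c.1).1 h)), if_neg hQ, mul_zero, Rat.cast_zero]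

/-- `P(o ↔ b) = pConn`. -/
theorem real_openConn_eq_pConn {n : ℕ} {l : List (Fin n × Fin n × ℚ)} (hnd : (wPairs l).Nodup)
    (hq : ∀ e ∈ l, 0 ≤ e.2.2 ∧ e.2.2 ≤ 1) (o b : Fin n) :
    (prodBernoulli (wOfList l)).real (openConn o b) = (pConn (partDist n l) o b : ℝ) := by
  classical
  rw [prodBernoulli_real_eq_wsum hnd hq, pConn]
  exact (cast_wcnt_partDist l _ (fun S => (↑S : Set (Sym2 (Fin n))) ∈ openConn o b)
    (fun ω => by simp only [beq_iff_eq]; exact labOf_getD_eq_iff ω o b)).symm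

/-- `P(a ↮ b) = pNotConn`. -/
theorem real_compl_openConn_eq_pNotConn {n : ℕ} {l : List (Fin n × Fin n × ℚ)}
    (hnd : (wPairs l).Nodup) (hq : ∀ e ∈ l, 0 ≤ e.2.2 ∧ e.2.2 ≤ 1) (a b : Fin n) :
    (prodBernoulli (wOfList l)).real (openConn a b)ᶜ = (pNotConn (partDist n l) a b : ℝ) := by
  classical
  rw [prodBernoulli_real_eq_wsum hnd hq, pNotConn]
  exact (cast_wcnt_partDist l _ (fun S => (↑S : Set (Sym2 (Fin n))) ∈ (openConn a b)ᶜ)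
    (fun ω => by
      simp only [Bool.not_eq_true', beq_eq_false_iff_ne, ne_eq]
      exact not_congr (labOf_getD_eq_iff ω a b))).symm

/-- `P(o ↔ A) = pConnSet` (`A` encoded by `maskL`). -/
theorem real_iUnion_openConn_eq_pConnSet {n : ℕ} {l : List (Fin n × Fin n × ℚ)}
    (hnd : (wPairs l).Nodup) (hq : ∀ e ∈ l, 0 ≤ e.2.2 ∧ e.2.2 ≤ 1) (o : Fin n) (A : Finset (Fin n)) :
    (prodBernoulli (wOfList l)).real (⋃ a ∈ A, openConn o a) =
      (pConnSet n (partDist n l) o (maskL A.toList) : ℝ) := by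
  classical
  rw [prodBernoulli_real_eq_wsum hnd hq, pConnSet]
  refine (cast_wcnt_partDist l _ (fun S => (↑S : Set (Sym2 (Fin n))) ∈ ⋃ a ∈ A, openConn o a)
    (fun ω => ?_)).symm
  rw [List.any_eq_true, Set.mem_iUnion₂]
  constructor
  · rintro ⟨a, -, h⟩
    rw [Bool.and_eq_true, beq_iff_eq] at h
    obtain ⟨a', ha', haa'⟩ := (testBit_maskL _ _).1 h.1
    exact ⟨a', Finset.mem_toList.1 ha', (labOf_getD_eq_iff ω o a').1 (by rw [haa']; exact h.2)⟩
  · rintro ⟨a, ha, h⟩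
    refine ⟨a, List.mem_range.2 a.2, ?_⟩
    rw [Bool.and_eq_true, beq_iff_eq]
    exact ⟨(testBit_maskL _ _).2 ⟨a, Finset.mem_toList.2 ha, rfl⟩, (labOf_getD_eq_iff ω o a).2 h⟩

/-! ### Soundness of the partition checker -/

/-- What `agPGraph n l = true` says. -/
theorem agPGraph_spec {n : ℕ} {l : List (Fin n × Fin n × ℚ)} (h : agPGraph n l = true) :
    (∀ e ∈ l, 0 ≤ e.2.2 ∧ e.2.2 ≤ 1) ∧ (wPairs l).Nodup ∧
      ∀ (o b : Fin n) {Am : ℕ}, Am < 2 ^ n → Am ≠ 0 →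
        ∃ a : Fin n, Am.testBit a = true ∧
          pConnSet n (partDist n l) o Am ≤ pConn (partDist n l) o b + pNotConn (partDist n l) a b := by
  simp only [agPGraph, Bool.and_eq_true, List.all_eq_true, decide_eq_true_eq, List.mem_range,
    Bool.or_eq_true, beq_iff_eq, List.any_eq_true] at h
  obtain ⟨⟨hq, hnd⟩, hall⟩ := h
  refine ⟨fun e he => hq e he, hnd, fun o b Am hAm hAm0 => ?_⟩
  obtain ⟨a, ha, hta, hle⟩ := (hall o o.2 b b.2 Am hAm).resolve_left hAm0
  refine ⟨⟨a, ha⟩, hta, ?_⟩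
  rw [getD_map_range _ _ o.2, getD_map_range _ _ hAm, getD_map_range _ _ o.2, getD_map_range _ _ b.2,
    getD_map_range _ _ ha, getD_map_range _ _ b.2] at hle
  exact hle

/-- **Soundness of the partition check.** If `agPGraph n l = true` then the additive gluing
inequality holds for the weighted graph `prodBernoulli (wOfList l)`, for every relay set `A`, all
vertices `o b` and every admissible slack `t`. -/
theorem additiveGluing_weighted_of_agPGraph {n : ℕ} {l : List (Fin n × Fin n × ℚ)}
    (h : agPGraph n l = true) (A : Finset (Fin n)) (o b : Fin n) (t : ℝ) (ht : 0 ≤ t)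
    (hrel : ∀ a ∈ A, 1 - t ≤ (prodBernoulli (wOfList l)).real (openConn a b)) :
    (prodBernoulli (wOfList l)).real (⋃ a ∈ A, openConn o a) - t ≤
      (prodBernoulli (wOfList l)).real (openConn o b) := by
  classical
  obtain ⟨hq, hnd, hall⟩ := agPGraph_spec h
  by_cases hA : A = ∅
  · subst hA
    simp only [Finset.notMem_empty, Set.iUnion_of_empty, Set.iUnion_empty, measureReal_empty]
    linarith [measureReal_nonneg (μ := prodBernoulli (wOfList l)) (s := openConn o b)]
  obtain ⟨a0, ha0⟩ := Finset.nonempty_iff_ne_empty.2 hA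
  have hAm0 : maskL A.toList ≠ 0 := by
    intro h0
    have := (testBit_maskL A.toList a0).2 ⟨a0, Finset.mem_toList.2 ha0, rfl⟩
    rw [h0, Nat.zero_testBit] at this
    exact Bool.false_ne_true this
  obtain ⟨a, hta, hle⟩ := hall o b (maskL_lt A.toList) hAm0
  have haA : a ∈ A := by
    obtain ⟨a', ha', haa'⟩ := (testBit_maskL A.toList a).1 hta
    rw [← Fin.ext haa']; exact Finset.mem_toList.1 ha'
  have hcast : (pConnSet n (partDist n l) o (maskL A.toList) : ℝ) ≤
      pConn (partDist n l) o b + pNotConn (partDist n l) a b := by exact_mod_cast hle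
  have hcompl : (prodBernoulli (wOfList l)).real (openConn a b)ᶜ =
      1 - (prodBernoulli (wOfList l)).real (openConn a b) :=
    probReal_compl_eq_one_sub (measurableSet_openConn_holds a b)
  have hrel' := hrel a haA
  rw [real_iUnion_openConn_eq_pConnSet hnd hq, real_openConn_eq_pConn hnd hq]
  rw [real_compl_openConn_eq_pNotConn hnd hq] at hcompl
  linarith

/-! ### Sample certificates -/

/-- `K₇` with every edge at weight `1/2`. -/
def K7half : List (Fin 7 × Fin 7 × ℚ) :=
  (allPairs 7).map fun p => (p.1, p.2, 1 / 2)

/-- The partition check passes on `K₇` at density `1/2` (every `(o, b, A)`; `native_decide`). -/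
theorem agPGraph_K7half : agPGraph 7 K7half = true := by native_decide

/-- An `8`-vertex two-level gadget with weights `1/4, 1/2, 3/4`: `o = 0`, relays `1,2,3` behind
private gadget vertices `4,5,6`, target `b = 7`. -/
def gadget8 : List (Fin 8 × Fin 8 × ℚ) :=
  [(0, 4, 3/4), (0, 5, 3/4), (0, 6, 3/4), (4, 1, 1/4), (5, 2, 1/4), (6, 3, 1/4), (4, 5, 1/2),
   (5, 6, 1/2), (4, 6, 1/2), (1, 7, 3/4), (2, 7, 3/4), (3, 7, 3/4), (1, 2, 1/4), (2, 3, 1/4),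
   (4, 7, 1/4), (0, 1, 1/4)]

/-- The partition check passes on `gadget8` (every `(o, b, A)`; `native_decide`). -/
theorem agPGraph_gadget8 : agPGraph 8 gadget8 = true := by native_decide

end Summit.CriticalPhenomena.PercolationContinuityZ3.Theorems.AdditiveGluing.Negative.Cert
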